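import Literature.AnabelianGeometry.EtaleTheta.ConstantMultipleRigiditySub
import Literature.AnabelianGeometry.EtaleTheta.Discharge.Sec1StandardType
import HarnessLib

/-!
# [EtTh] Thm 1.10 (i), second clause («determines this collection of classes up to multiplication by
# ±1») — PROOF of the typed `Thm110iUnique` from the two K2 intermediate statements (row T110.i.r8)

S. Mochizuki, *The étale theta function …*, Publ. RIMS 45 (2009), Thm 1.10 (i), PRIMS p.255–256
[cite: MochizukiEtTh2009, Thm 1.10 (i) p.29]: «… a property that determines this collection of classes up
to multiplication by ±1» — «(i) … follow[s] formally from assertion (ii) [cf. also the series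
representation of Proposition 1.4]».  Cell sub-DAG `plan/L2/SUBDAG-EtTh-Thm110.md` row T110.i.r8
(holder abc-iut-w5-d140; honest shape agreed with the §1 owner abc-iut-L2-t1).  PROOF-ONLY companion
(no `def`) of `ConstantMultipleRigidity.lean` / `ConstantMultipleRigiditySub.lean`.

PROVED: `MuTwoSetting.thm110iUnique_of_formula` — for `η̈^Θ` with (V2′) `Thm110UnitClassEquivariance`
(the unit Kummer classes `infl κ(u)` are fixed by the orbit group) and (V1′) `StandardValuesFormula` at
`τ` together with `StandardValuesInvSymm` (the values at `τ⁻¹` are the negatives of those at `τ`), the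
typed `Thm110iUnique` holds: if both `η̈^{Θ,Z}` and `(u·η̈)^{Θ,Z}`, `u ∈ O^×_{K̈}`, are of standard type
then `u = ±1`.  Ingredients: the values of `(u·η̈)` are `u ·` the values of `η̈`
(`valuesAt_unitMul`: `NonCuspidalPoint.evalAt` and `ContH1.conj/res` are monoid homs, `evalAt_kum`,
(V2′)); in `{q̈^{−a²}·v₀}` the element of minimal absolute value is `v₀` because `‖q̈‖ < 1`
(`norm_qX_lt_one`, `sqrtqX_sq`).  No thetaDdot-level input is needed here (the model-level discharge of
(V1′) is abc-iut-L2-t6's `ClassicalThetaValueOrders.lean`).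
HONEST FRAMING: conditional on two typed intermediate statements of the printed proof; typed ≠ proved
for [EtTh]; nothing here bears on the disputed [IUTchIII] Cor. 3.12.
v2 (2026-08-26, finding F-L2t6g4-1 of abc-iut-L2-t6): (V1′) is sign-blind — on the `ε_Z = [−q̈]` branch
of Def 1.7 the values at `τ` are `{(−1)^a·q̈^{−a²}·v₀}`; the repaired statement is (V1″)
`StandardValuesFormulaSigned` (branch sign `s = ±1`, `ConstantMultipleRigiditySub.lean` v3).  PROVED here:
`MuTwoSetting.thm110iUnique_of_signedFormula` — the same conclusion from (V2′) + (V1″) + `InvSymm`, valid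
on BOTH branches (`‖s^a‖ = 1`, so the minimal-norm element is still the `a = 0` value:
`coe_eq_of_minimal_signed`); v1's `thm110iUnique_of_formula` = v2 ∘ `standardValuesFormulaSigned_of_formula`.
-/

noncomputable section

namespace Literature.AnabelianGeometry.EtaleTheta

open Literature.AnabelianGeometry.SemiGraphs

namespace MuTwoSetting

variable {p : ℕ} [Fact p.Prime] {M : MuTwoSetting p}

/-- `‖q̈‖ < 1` (`q̈² = q_X`, `‖q_X‖ < 1`). [cite: MochizukiEtTh2009, §1 p.17] -/
theorem norm_qdd_lt_one : ‖M.toThetaSetting.qdd‖ < 1 := by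
  have h : ‖M.toThetaSetting.qdd‖ ^ 2 < 1 := by
    rw [← norm_pow]
    change ‖M.sqrtqX ^ 2‖ < 1
    rw [M.sqrtqX_sq]; exact M.norm_qX_lt_one
  nlinarith [norm_nonneg M.toThetaSetting.qdd]

/-- `q̈ ≠ 0`. [cite: MochizukiEtTh2009, §1 p.17] -/
theorem qdd_ne_zero : M.toThetaSetting.qdd ≠ 0 := by
  intro h
  apply M.qX_ne_zero
  rw [← M.sqrtqX_sq]
  change M.toThetaSetting.qdd ^ 2 = 0
  rw [h]; ring

/-- For `a ≠ 0`, `‖q̈^{−a²}‖ > 1`; in general `‖q̈^{−a²}‖ ≥ 1` with equality iff `a = 0`: here the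
`≥ 1` part and the strict part. [cite: MochizukiEtTh2009, Prop 1.4 (ii) p.20] -/
theorem one_le_norm_qdd_zpow (a : ℤ) : 1 ≤ ‖M.toThetaSetting.qdd ^ (-(a * a))‖ := by
  rw [norm_zpow, zpow_neg, zpow_mul]
  have h0 : 0 < ‖M.toThetaSetting.qdd‖ := norm_pos_iff.mpr qdd_ne_zero
  have hsq : (‖M.toThetaSetting.qdd‖ ^ a) ^ a = (‖M.toThetaSetting.qdd‖ ^ (a * a)) := (zpow_mul _ a a).symm
  rw [hsq]
  have haa : (0 : ℤ) ≤ a * a := mul_self_nonneg a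
  obtain ⟨n, hn⟩ := Int.eq_ofNat_of_zero_le haa
  rw [hn, zpow_natCast]
  have hle : ‖M.toThetaSetting.qdd‖ ^ n ≤ 1 := pow_le_one₀ h0.le norm_qdd_lt_one.le
  have hpos : 0 < ‖M.toThetaSetting.qdd‖ ^ n := pow_pos h0 n
  exact one_le_inv_iff₀.mpr ⟨hpos, hle⟩

/-- `‖q̈^{−a²}‖ ≤ 1` forces `a = 0`. [cite: MochizukiEtTh2009, Prop 1.4 (ii) p.20] -/
theorem eq_zero_of_norm_qdd_zpow_le_one {a : ℤ} (h : ‖M.toThetaSetting.qdd ^ (-(a * a))‖ ≤ 1) :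
    a = 0 := by
  by_contra ha
  have h0 : 0 < ‖M.toThetaSetting.qdd‖ := norm_pos_iff.mpr qdd_ne_zero
  have haa : (0 : ℤ) < a * a := mul_self_pos.mpr ha
  obtain ⟨n, hn⟩ := Int.eq_ofNat_of_zero_le haa.le
  have hn0 : n ≠ 0 := by rintro rfl; simp at hn; omega
  rw [norm_zpow, zpow_neg, hn, zpow_natCast] at h
  have hlt : ‖M.toThetaSetting.qdd‖ ^ n < 1 := pow_lt_one₀ h0.le norm_qdd_lt_one hn0
  have hpos : 0 < ‖M.toThetaSetting.qdd‖ ^ n := pow_pos h0 n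
  have : 1 < (‖M.toThetaSetting.qdd‖ ^ n)⁻¹ := (one_lt_inv₀ hpos).mpr hlt
  linarith

variable {E : M.toThetaSetting.KummerData}

/-- Coercion `K̈^× → ℚ̄_p` is multiplicative (bookkeeping). [cite: MochizukiEtTh2009, §1 p.17] -/
theorem coe_units_mul (v w : (↥M.Kdd)ˣ) :
    (((v * w : (↥M.Kdd)ˣ) : M.Kdd) : PadicAlgCl p) =
      ((v : M.Kdd) : PadicAlgCl p) * ((w : M.Kdd) : PadicAlgCl p) := by
  rw [Units.val_mul]; rfl

/-- Units of `O^×_{K̈}` have absolute value `1` (definition of `unitsOKdd`). [cite: MochizukiEtTh2009, §1 p.17] -/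
theorem norm_coe_eq_one_of_mem_unitsOKdd {u : (↥M.Kdd)ˣ} (hu : u ∈ M.toThetaSetting.unitsOKdd) :
    ‖((u : M.Kdd) : PadicAlgCl p)‖ = 1 := hu

/-- **The values of `(u·η̈)^{Θ,Z}` are `u ·` the values of `η̈^{Θ,Z}`** (at any point), granted (V2′)
that the unit Kummer class `infl κ(u)` is fixed by the orbit group: `conj σ`, `res` and `evalAt` are
monoid homomorphisms and `evalAt (res (infl κ(u))) = u` (`evalAt_kum`).
[cite: MochizukiEtTh2009, Prop 1.4 (iii) p.22] -/
theorem valuesAt_unitMul (hC : M.toThetaSetting.Compat) (εZ : M.GtpC)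
    (hV2 : Thm110UnitClassEquivariance hC εZ E) {u : (↥M.Kdd)ˣ} (hu : u ∈ M.toThetaSetting.unitsOKdd)
    (x : M.toThetaSetting.H1 M.toThetaSetting.GtpYdd) (y₀ : ThetaSetting.NonCuspidalPoint E)
    (v : (↥M.Kdd)ˣ) :
    v ∈ valuesAt hC εZ
        (M.toThetaSetting.inflTheta M.toThetaSetting.GtpYdd (E.kumYdd (E.toKddHat u)) * x) y₀ ↔
      u⁻¹ * v ∈ valuesAt hC εZ x y₀ := by
  haveI := hC.GtpYdd_normal
  set c := M.toThetaSetting.inflTheta M.toThetaSetting.GtpYdd (E.kumYdd (E.toKddHat u)) with hc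
  have hres : y₀.evalAt (ContH1.res M.toTheta M.toThetaSetting.DeltaTheta y₀.Dpt_le c) =
      E.toKddHat u := y₀.evalAt_kum (E.toKddHat u)
  constructor
  · rintro ⟨y, ⟨σ, hσ, rfl⟩, hy⟩
    refine ⟨ContH1.conj M.toTheta M.toThetaSetting.DeltaTheta σ x, ⟨σ, hσ, rfl⟩, ?_⟩
    rw [map_mul, hV2 σ hσ u hu, map_mul, map_mul, hres] at hy
    rw [map_mul, map_inv, ← hy, inv_mul_cancel_left]
  · rintro ⟨y, ⟨σ, hσ, rfl⟩, hy⟩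
    refine ⟨ContH1.conj M.toTheta M.toThetaSetting.DeltaTheta σ (c * x), ⟨σ, hσ, rfl⟩, ?_⟩
    rw [map_mul, hV2 σ hσ u hu, map_mul, map_mul, hres, hy, map_mul, map_inv, mul_inv_cancel_left]

/-- In a value set of the shape `{q̈^{−a²}·v₀ | a ∈ ℤ}` scaled by a unit `u`, an element of minimal
absolute value is `u·v₀` (as an element of `ℚ̄_p`). [cite: MochizukiEtTh2009, Def 1.9 (ii) p.29] -/
theorem coe_eq_of_minimal {V : Set (↥M.Kdd)ˣ} {v₀ u : (↥M.Kdd)ˣ}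
    (hu : ‖((u : M.Kdd) : PadicAlgCl p)‖ = 1)
    (hV : ∀ v : (↥M.Kdd)ˣ, v ∈ V ↔
      ∃ a : ℤ, (((u⁻¹ * v : (↥M.Kdd)ˣ) : M.Kdd) : PadicAlgCl p) =
        M.toThetaSetting.qdd ^ (-(a * a)) * ((v₀ : M.Kdd) : PadicAlgCl p))
    {v : (↥M.Kdd)ˣ} (hv : v ∈ V)
    (hmin : ∀ w : (↥M.Kdd)ˣ, w ∈ V →
      ‖((v : M.Kdd) : PadicAlgCl p)‖ ≤ ‖((w : M.Kdd) : PadicAlgCl p)‖) :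
    ((v : M.Kdd) : PadicAlgCl p) = ((u : M.Kdd) : PadicAlgCl p) * ((v₀ : M.Kdd) : PadicAlgCl p) := by
  obtain ⟨a, ha⟩ := (hV v).mp hv
  -- the element `u · v₀` (a = 0) lies in the set
  have h0 : u * v₀ ∈ V := (hV (u * v₀)).mpr ⟨0, by rw [inv_mul_cancel_left]; simp⟩
  have hle := hmin (u * v₀) h0
  have hv0 : ((v₀ : M.Kdd) : PadicAlgCl p) ≠ 0 := by
    intro h
    have : ((v₀ : M.Kdd) : PadicAlgCl p) * (((v₀⁻¹ : (↥M.Kdd)ˣ) : M.Kdd) : PadicAlgCl p) = 1 := by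
      rw [← coe_units_mul, mul_inv_cancel]; rfl
    rw [h, zero_mul] at this; exact zero_ne_one this
  have huv : ((v : M.Kdd) : PadicAlgCl p) =
      ((u : M.Kdd) : PadicAlgCl p) * (M.toThetaSetting.qdd ^ (-(a * a)) * ((v₀ : M.Kdd) : PadicAlgCl p)) := by
    rw [← ha, ← coe_units_mul, mul_inv_cancel_left]
  have hnorm : ‖((v : M.Kdd) : PadicAlgCl p)‖ =
      ‖M.toThetaSetting.qdd ^ (-(a * a))‖ * ‖((v₀ : M.Kdd) : PadicAlgCl p)‖ := by
    rw [huv, norm_mul, norm_mul, hu, one_mul]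
  have hnorm0 : ‖(((u * v₀ : (↥M.Kdd)ˣ) : M.Kdd) : PadicAlgCl p)‖ = ‖((v₀ : M.Kdd) : PadicAlgCl p)‖ := by
    rw [coe_units_mul, norm_mul, hu, one_mul]
  rw [hnorm, hnorm0] at hle
  have hpos : 0 < ‖((v₀ : M.Kdd) : PadicAlgCl p)‖ := norm_pos_iff.mpr hv0
  have hq : ‖M.toThetaSetting.qdd ^ (-(a * a))‖ ≤ 1 := by
    by_contra hgt
    rw [not_le] at hgt
    nlinarith
  have ha0 : a = 0 := eq_zero_of_norm_qdd_zpow_le_one hq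
  rw [huv, ha0]; simp

/-- **[EtTh] Thm 1.10 (i), uniqueness clause — the typed `Thm110iUnique`, PROVED from the two K2
intermediate statements (V2′) `Thm110UnitClassEquivariance` and (V1′) `StandardValuesFormula` +
`StandardValuesInvSymm` for `η̈^Θ`**: if `η̈^{Θ,Z}` and `(u·η̈)^{Θ,Z}` (`u ∈ O^×_{K̈}`) are both of standard
type, then `u = ±1`. [cite: MochizukiEtTh2009, Thm 1.10 (i) p.29] -/
theorem thm110iUnique_of_formula (hC : M.toThetaSetting.Compat) {εZ : M.GtpC}
    (hZ : M.IsAdmissibleEpsZ εZ) (E : M.toThetaSetting.EtaleThetaData)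
    (S : M.StandardData E.toKummerData)
    (hV2 : Thm110UnitClassEquivariance hC εZ E.toKummerData)
    (hV1 : StandardValuesFormula hC εZ S E.etaDd)
    (hInv : StandardValuesInvSymm hC εZ S E.etaDd) :
    Thm110iUnique hC hZ E S := by
  intro u hu _hstd hstd'
  have hun : ‖((u : M.Kdd) : PadicAlgCl p)‖ = 1 := norm_coe_eq_one_of_mem_unitsOKdd hu
  obtain ⟨v₀, -, hform⟩ := hV1
  -- shorthand for the translated class
  set x' := M.toThetaSetting.inflTheta M.toThetaSetting.GtpYdd (E.kumYdd (E.toKddHat u)) * E.etaDd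
  -- value sets of `x'` at τ and τ⁻¹ in terms of those of `η̈`
  have hτ : ∀ v, v ∈ valuesAt hC εZ x' S.tau ↔
      ∃ a : ℤ, (((u⁻¹ * v : (↥M.Kdd)ˣ) : M.Kdd) : PadicAlgCl p) =
        M.toThetaSetting.qdd ^ (-(a * a)) * ((v₀ : M.Kdd) : PadicAlgCl p) := fun v => by
    rw [valuesAt_unitMul hC εZ hV2 hu, hform]
  -- at τ⁻¹ the values are the negatives: package with `v₀' := -v₀`
  have hτ' : ∀ v, v ∈ valuesAt hC εZ x' S.tauInv ↔
      ∃ a : ℤ, (((u⁻¹ * v : (↥M.Kdd)ˣ) : M.Kdd) : PadicAlgCl p) =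
        M.toThetaSetting.qdd ^ (-(a * a)) * (((-v₀ : (↥M.Kdd)ˣ) : M.Kdd) : PadicAlgCl p) := fun v => by
    rw [valuesAt_unitMul hC εZ hV2 hu, hInv]
    constructor
    · rintro ⟨w, hw, hvw⟩
      obtain ⟨a, ha⟩ := (hform w).mp hw
      refine ⟨a, ?_⟩
      rw [hvw, ha, Units.val_neg]
      push_cast
      ring
    · rintro ⟨a, ha⟩
      refine ⟨-(u⁻¹ * v), (hform _).mpr ⟨a, ?_⟩, ?_⟩
      · rw [Units.val_neg] at ha ⊢
        push_cast at ha ⊢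
        linear_combination -ha
      · rw [Units.val_neg]; push_cast; ring
  -- standard type of `x'`: a minimal element equal to ±1 in one of the two standard sets
  obtain ⟨V, hVstd, v, hvV, hmin, -, hpm⟩ := hstd'
  -- standard type of `η̈`: gives `v₀ = ±1` — extracted the same way with `u := 1`
  obtain ⟨V₁, hV₁std, v₁, hv₁V, hmin₁, -, hpm₁⟩ := _hstd
  have hone : ‖(((1 : (↥M.Kdd)ˣ) : M.Kdd) : PadicAlgCl p)‖ = 1 := by simp
  have hform1 : ∀ w, w ∈ valuesAt hC εZ E.etaDd S.tau ↔
      ∃ a : ℤ, ((((1 : (↥M.Kdd)ˣ)⁻¹ * w : (↥M.Kdd)ˣ) : M.Kdd) : PadicAlgCl p) =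
        M.toThetaSetting.qdd ^ (-(a * a)) * ((v₀ : M.Kdd) : PadicAlgCl p) := fun w => by
    rw [inv_one, one_mul]; exact hform w
  have hform1' : ∀ w, w ∈ valuesAt hC εZ E.etaDd S.tauInv ↔
      ∃ a : ℤ, ((((1 : (↥M.Kdd)ˣ)⁻¹ * w : (↥M.Kdd)ˣ) : M.Kdd) : PadicAlgCl p) =
        M.toThetaSetting.qdd ^ (-(a * a)) * (((-v₀ : (↥M.Kdd)ˣ) : M.Kdd) : PadicAlgCl p) := fun w => by
    rw [inv_one, one_mul, hInv]
    constructor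
    · rintro ⟨w', hw', hww'⟩
      obtain ⟨a, ha⟩ := (hform w').mp hw'
      refine ⟨a, ?_⟩
      rw [hww', ha, Units.val_neg]; push_cast; ring
    · rintro ⟨a, ha⟩
      refine ⟨-w, (hform _).mpr ⟨a, ?_⟩, ?_⟩
      · rw [Units.val_neg] at ha ⊢
        push_cast at ha ⊢
        linear_combination -ha
      · rw [Units.val_neg]; push_cast; ring
  -- `v₀ = ±1` as an element of ℚ̄_p
  have hv₀ : ((v₀ : M.Kdd) : PadicAlgCl p) = 1 ∨ ((v₀ : M.Kdd) : PadicAlgCl p) = -1 := by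
    rcases hV₁std with rfl | rfl
    · have key := coe_eq_of_minimal (V := valuesAt hC εZ E.etaDd S.tau) hone hform1 hv₁V hmin₁
      simp only [Units.val_one, OneMemClass.coe_one, one_mul] at key
      rw [← key]; exact hpm₁
    · have key := coe_eq_of_minimal (V := valuesAt hC εZ E.etaDd S.tauInv) hone hform1' hv₁V hmin₁
      simp only [Units.val_one, OneMemClass.coe_one, one_mul, Units.val_neg] at key
      push_cast at key
      rcases hpm₁ with h | h <;> [right; left] <;> rw [h] at key <;> linear_combination key
  -- `u · (±v₀) = ±1`
  have huv : ((u : M.Kdd) : PadicAlgCl p) * ((v₀ : M.Kdd) : PadicAlgCl p) = 1 ∨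
      ((u : M.Kdd) : PadicAlgCl p) * ((v₀ : M.Kdd) : PadicAlgCl p) = -1 := by
    rcases hVstd with rfl | rfl
    · have key := coe_eq_of_minimal (V := valuesAt hC εZ x' S.tau) hun hτ hvV hmin
      rw [← key]; exact hpm
    · have key := coe_eq_of_minimal (V := valuesAt hC εZ x' S.tauInv) hun hτ' hvV hmin
      rw [Units.val_neg] at key; push_cast at key
      rcases hpm with h | h <;> [right; left] <;> rw [h] at key <;> linear_combination key
  rcases hv₀ with h0 | h0 <;> rcases huv with h1 | h1 <;> rw [h0] at h1 <;>
    first | (left; linear_combination h1) | (right; linear_combination h1) |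
      (left; linear_combination -h1) | (right; linear_combination -h1)

/-! ### v2: the SIGNED value formula (V1″), both branches of `ε_Z` (finding F-L2t6g4-1) -/

/-- A sign `s = ±1` of `ℚ̄_p` has `‖s^a‖ = 1` for every `a ∈ ℤ`. [cite: MochizukiEtTh2009, Prop 1.4 (ii) p.20] -/
theorem norm_sign_zpow {s : PadicAlgCl p} (hs : s = 1 ∨ s = -1) (a : ℤ) : ‖s ^ a‖ = 1 := by
  rw [norm_zpow]
  rcases hs with rfl | rfl
  · rw [norm_one, one_zpow]
  · rw [norm_neg, norm_one, one_zpow]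

/-- In a value set of the shape `{s^a · q̈^{−a²}·v₀ | a ∈ ℤ}` (`s = ±1` the branch sign of `ε_Z`)
scaled by a unit `u`, an element of minimal absolute value is `u·v₀` (as an element of `ℚ̄_p`): the
`a = 0` value, since `‖s^a‖ = 1` and `‖q̈‖ < 1`. [cite: MochizukiEtTh2009, Def 1.9 (ii) p.29] -/
theorem coe_eq_of_minimal_signed {V : Set (↥M.Kdd)ˣ} {v₀ u : (↥M.Kdd)ˣ} {s : PadicAlgCl p}
    (hs : s = 1 ∨ s = -1) (hu : ‖((u : M.Kdd) : PadicAlgCl p)‖ = 1)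
    (hV : ∀ v : (↥M.Kdd)ˣ, v ∈ V ↔
      ∃ a : ℤ, (((u⁻¹ * v : (↥M.Kdd)ˣ) : M.Kdd) : PadicAlgCl p) =
        s ^ a * M.toThetaSetting.qdd ^ (-(a * a)) * ((v₀ : M.Kdd) : PadicAlgCl p))
    {v : (↥M.Kdd)ˣ} (hv : v ∈ V)
    (hmin : ∀ w : (↥M.Kdd)ˣ, w ∈ V →
      ‖((v : M.Kdd) : PadicAlgCl p)‖ ≤ ‖((w : M.Kdd) : PadicAlgCl p)‖) :
    ((v : M.Kdd) : PadicAlgCl p) = ((u : M.Kdd) : PadicAlgCl p) * ((v₀ : M.Kdd) : PadicAlgCl p) := by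
  obtain ⟨a, ha⟩ := (hV v).mp hv
  -- the element `u · v₀` (a = 0) lies in the set
  have h0 : u * v₀ ∈ V := (hV (u * v₀)).mpr ⟨0, by rw [inv_mul_cancel_left]; simp⟩
  have hle := hmin (u * v₀) h0
  have hv0 : ((v₀ : M.Kdd) : PadicAlgCl p) ≠ 0 := by
    intro h
    have : ((v₀ : M.Kdd) : PadicAlgCl p) * (((v₀⁻¹ : (↥M.Kdd)ˣ) : M.Kdd) : PadicAlgCl p) = 1 := by
      rw [← coe_units_mul, mul_inv_cancel]; rfl
    rw [h, zero_mul] at this; exact zero_ne_one this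
  have huv : ((v : M.Kdd) : PadicAlgCl p) =
      ((u : M.Kdd) : PadicAlgCl p) *
        (s ^ a * M.toThetaSetting.qdd ^ (-(a * a)) * ((v₀ : M.Kdd) : PadicAlgCl p)) := by
    rw [← ha, ← coe_units_mul, mul_inv_cancel_left]
  have hnorm : ‖((v : M.Kdd) : PadicAlgCl p)‖ =
      ‖M.toThetaSetting.qdd ^ (-(a * a))‖ * ‖((v₀ : M.Kdd) : PadicAlgCl p)‖ := by
    rw [huv, norm_mul, norm_mul, norm_mul, hu, norm_sign_zpow hs, one_mul, one_mul]
  have hnorm0 : ‖(((u * v₀ : (↥M.Kdd)ˣ) : M.Kdd) : PadicAlgCl p)‖ = ‖((v₀ : M.Kdd) : PadicAlgCl p)‖ := by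
    rw [coe_units_mul, norm_mul, hu, one_mul]
  rw [hnorm, hnorm0] at hle
  have hpos : 0 < ‖((v₀ : M.Kdd) : PadicAlgCl p)‖ := norm_pos_iff.mpr hv0
  have hq : ‖M.toThetaSetting.qdd ^ (-(a * a))‖ ≤ 1 := by
    by_contra hgt
    rw [not_le] at hgt
    nlinarith
  have ha0 : a = 0 := eq_zero_of_norm_qdd_zpow_le_one hq
  rw [huv, ha0]; simp

/-- **[EtTh] Thm 1.10 (i), uniqueness clause — the typed `Thm110iUnique`, PROVED from (V2′)
`Thm110UnitClassEquivariance` and the SIGNED value formula (V1″) `StandardValuesFormulaSigned` +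
`StandardValuesInvSymm` for `η̈^Θ`** (valid on BOTH admissible branches of `ε_Z`, finding F-L2t6g4-1):
if `η̈^{Θ,Z}` and `(u·η̈)^{Θ,Z}` (`u ∈ O^×_{K̈}`) are both of standard type, then `u = ±1`.  The sign
`s^a` has absolute value `1`, so the element of minimal absolute value is still the `a = 0` value and
the `±1` bookkeeping of `thm110iUnique_of_formula` goes through unchanged.
[cite: MochizukiEtTh2009, Thm 1.10 (i) p.29] -/
theorem thm110iUnique_of_signedFormula (hC : M.toThetaSetting.Compat) {εZ : M.GtpC}
    (hZ : M.IsAdmissibleEpsZ εZ) (E : M.toThetaSetting.EtaleThetaData)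
    (S : M.StandardData E.toKummerData)
    (hV2 : Thm110UnitClassEquivariance hC εZ E.toKummerData)
    (hV1 : StandardValuesFormulaSigned hC εZ S E.etaDd)
    (hInv : StandardValuesInvSymm hC εZ S E.etaDd) :
    Thm110iUnique hC hZ E S := by
  intro u hu _hstd hstd'
  have hun : ‖((u : M.Kdd) : PadicAlgCl p)‖ = 1 := norm_coe_eq_one_of_mem_unitsOKdd hu
  obtain ⟨v₀, s, hs, -, hform⟩ := hV1
  -- shorthand for the translated class
  set x' := M.toThetaSetting.inflTheta M.toThetaSetting.GtpYdd (E.kumYdd (E.toKddHat u)) * E.etaDd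
  -- value sets of `x'` at τ and τ⁻¹ in terms of those of `η̈`
  have hτ : ∀ v, v ∈ valuesAt hC εZ x' S.tau ↔
      ∃ a : ℤ, (((u⁻¹ * v : (↥M.Kdd)ˣ) : M.Kdd) : PadicAlgCl p) =
        s ^ a * M.toThetaSetting.qdd ^ (-(a * a)) * ((v₀ : M.Kdd) : PadicAlgCl p) := fun v => by
    rw [valuesAt_unitMul hC εZ hV2 hu, hform]
  -- at τ⁻¹ the values are the negatives: package with `v₀' := -v₀`
  have hτ' : ∀ v, v ∈ valuesAt hC εZ x' S.tauInv ↔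
      ∃ a : ℤ, (((u⁻¹ * v : (↥M.Kdd)ˣ) : M.Kdd) : PadicAlgCl p) =
        s ^ a * M.toThetaSetting.qdd ^ (-(a * a)) * (((-v₀ : (↥M.Kdd)ˣ) : M.Kdd) : PadicAlgCl p) :=
    fun v => by
    rw [valuesAt_unitMul hC εZ hV2 hu, hInv]
    constructor
    · rintro ⟨w, hw, hvw⟩
      obtain ⟨a, ha⟩ := (hform w).mp hw
      refine ⟨a, ?_⟩
      rw [hvw, ha, Units.val_neg]
      push_cast
      ring
    · rintro ⟨a, ha⟩
      refine ⟨-(u⁻¹ * v), (hform _).mpr ⟨a, ?_⟩, ?_⟩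
      · rw [Units.val_neg] at ha ⊢
        push_cast at ha ⊢
        linear_combination -ha
      · rw [Units.val_neg]; push_cast; ring
  -- standard type of `x'`: a minimal element equal to ±1 in one of the two standard sets
  obtain ⟨V, hVstd, v, hvV, hmin, -, hpm⟩ := hstd'
  -- standard type of `η̈`: gives `v₀ = ±1` — extracted the same way with `u := 1`
  obtain ⟨V₁, hV₁std, v₁, hv₁V, hmin₁, -, hpm₁⟩ := _hstd
  have hone : ‖(((1 : (↥M.Kdd)ˣ) : M.Kdd) : PadicAlgCl p)‖ = 1 := by simp
  have hform1 : ∀ w, w ∈ valuesAt hC εZ E.etaDd S.tau ↔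
      ∃ a : ℤ, ((((1 : (↥M.Kdd)ˣ)⁻¹ * w : (↥M.Kdd)ˣ) : M.Kdd) : PadicAlgCl p) =
        s ^ a * M.toThetaSetting.qdd ^ (-(a * a)) * ((v₀ : M.Kdd) : PadicAlgCl p) := fun w => by
    rw [inv_one, one_mul]; exact hform w
  have hform1' : ∀ w, w ∈ valuesAt hC εZ E.etaDd S.tauInv ↔
      ∃ a : ℤ, ((((1 : (↥M.Kdd)ˣ)⁻¹ * w : (↥M.Kdd)ˣ) : M.Kdd) : PadicAlgCl p) =
        s ^ a * M.toThetaSetting.qdd ^ (-(a * a)) * (((-v₀ : (↥M.Kdd)ˣ) : M.Kdd) : PadicAlgCl p) :=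
    fun w => by
    rw [inv_one, one_mul, hInv]
    constructor
    · rintro ⟨w', hw', hww'⟩
      obtain ⟨a, ha⟩ := (hform w').mp hw'
      refine ⟨a, ?_⟩
      rw [hww', ha, Units.val_neg]; push_cast; ring
    · rintro ⟨a, ha⟩
      refine ⟨-w, (hform _).mpr ⟨a, ?_⟩, ?_⟩
      · rw [Units.val_neg] at ha ⊢
        push_cast at ha ⊢
        linear_combination -ha
      · rw [Units.val_neg]; push_cast; ring
  -- `v₀ = ±1` as an element of ℚ̄_p
  have hv₀ : ((v₀ : M.Kdd) : PadicAlgCl p) = 1 ∨ ((v₀ : M.Kdd) : PadicAlgCl p) = -1 := by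
    rcases hV₁std with rfl | rfl
    · have key := coe_eq_of_minimal_signed (V := valuesAt hC εZ E.etaDd S.tau) hs hone hform1 hv₁V hmin₁
      simp only [Units.val_one, OneMemClass.coe_one, one_mul] at key
      rw [← key]; exact hpm₁
    · have key :=
        coe_eq_of_minimal_signed (V := valuesAt hC εZ E.etaDd S.tauInv) hs hone hform1' hv₁V hmin₁
      simp only [Units.val_one, OneMemClass.coe_one, one_mul, Units.val_neg] at key
      push_cast at key
      rcases hpm₁ with h | h <;> [right; left] <;> rw [h] at key <;> linear_combination key
  -- `u · (±v₀) = ±1`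
  have huv : ((u : M.Kdd) : PadicAlgCl p) * ((v₀ : M.Kdd) : PadicAlgCl p) = 1 ∨
      ((u : M.Kdd) : PadicAlgCl p) * ((v₀ : M.Kdd) : PadicAlgCl p) = -1 := by
    rcases hVstd with rfl | rfl
    · have key := coe_eq_of_minimal_signed (V := valuesAt hC εZ x' S.tau) hs hun hτ hvV hmin
      rw [← key]; exact hpm
    · have key := coe_eq_of_minimal_signed (V := valuesAt hC εZ x' S.tauInv) hs hun hτ' hvV hmin
      rw [Units.val_neg] at key; push_cast at key
      rcases hpm with h | h <;> [right; left] <;> rw [h] at key <;> linear_combination key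
  rcases hv₀ with h0 | h0 <;> rcases huv with h1 | h1 <;> rw [h0] at h1 <;>
    first | (left; linear_combination h1) | (right; linear_combination h1) |
      (left; linear_combination -h1) | (right; linear_combination -h1)

end MuTwoSetting

end Literature.AnabelianGeometry.EtaleTheta

end
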